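import Literature.MathematicalPhysics.QuantumFieldTheory.BalabanImbrieJaffe1984to88.BIJ88GaussMultiShell307
import Literature.MathematicalPhysics.QuantumFieldTheory.BalabanImbrieJaffe1984to88.BIJ88WalkFormLocated309
import Literature.MathematicalPhysics.QuantumFieldTheory.BalabanImbrieJaffe1984to88.BIJ88ExpectTilt305

/-!
# `BalabanImbrieJaffe1984to88.BIJ88GaussShellInterpolated309` — T. Bałaban, J. Imbrie, A. Jaffe, *Effective action and cluster properties of
the abelian Higgs model*, Commun. Math. Phys. **114** (1988) 257–315 [BalabanImbrieJaffe1988]: p. 305 [PDF 49] (Sect. 5.13, the interpolated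
Gaussian expectation `⟨·⟩_s` of (5.13.3)), p. 307 [PDF 51] (*"Functional derivatives hitting χ-factors … produce factors e^{−cp(e_k)²} after
integrating with respect to A^{(k)″}, φ^{(k)″}. These derivatives are supported at |A^{(k)″}| ≥ cp(e_k) or |φ^{(k)″}| ≥ cp(e_k) (here we use
the fact that the translation vanishes). Thus we can use the arguments at the end of Sect. 14 in [3] to extract the factors e^{−cp(e_k)²}
from the Gaussian measure"*) and p. 309 [PDF 53] ((5.14.3)–(5.14.4)) — **THE GAUSSIAN SHELL FACTORS UNDER THE INTERPOLATED EXPECTATION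
`⟨·⟩_s`, UNIFORMLY IN `s`**.

The located (5.13.3) (`BIJ88WalkFormLocated309.expect_fD_uD_eq_expansionSum_trains`) integrates each term against
`gexp (prec blk Δ X s) (src blk ℱ X)` (`BIJ88TruncationConnected306.gexp A f G = ∫G e^{−½⟨φ,Aφ⟩+⟨f,φ⟩}/∫e^{−½⟨φ,Aφ⟩+⟨f,φ⟩}`) at an
INTERPOLATED parameter `s ∈ [0,1]^I`, whereas the multi-shell bound of `BIJ88GaussMultiShell307` §3 was fed with the law of a region at the
corner `1_W` (`fieldLaw`).  THIS FILE supplies the same bound for every `s`: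
* §1 (any positive definite `A` on a finite index type, any source `f`): **`gexp A f G = ∫ G d(μ_{A⁻¹} ∘ (· + A⁻¹f)⁻¹)`** — the normalized
  tilted Gaussian is the centred probability Gaussian `dμ_{A⁻¹}` (`B2Eq228Conditioning.gaussProb`) translated by the mean field `A⁻¹f`
  (`gexp_eq_integral_shift`, `gexp_eq_integral_map`; completing the square, `B2Eq228Conditioning.integral_tilt`); hence
  `|gexp A f G| ≤ M · Law(S)` when `|G| ≤ M·1_S` (`abs_gexp_le_of_indicator`); linear functionals are jointly Gaussian under the translated
  law (`hasGaussianLaw_linear_shift`) with `Var[a·ω] = a·A⁻¹a` (`variance_dotProduct_shift`), `E[a·ω] = a·A⁻¹f` (`integral_dotProduct_shift`),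
  so `A ≥ m` and a frame letter `|ℓ ω| ≤ Λ‖ω‖` give `Var ≤ Λ²/m`, `|E| ≤ ΛF/m` (`variance_linear_shift_le`, `abs_integral_linear_shift_le`), and
  `BIJ88GaussMultiShell307.measureReal_forall_abs_ge_le_of_hasGaussianLaw` gives **`Law{a_k ≤ |ℓ_k| ∀k} ≤ Π_k 2e^{−a_k(a_k−2ΛF/m)/(2Λ²/m)}`**
  (`shift_real_forall_abs_ge_le`) and **`|gexp A f G| ≤ M · Π_k 2e^{−a_k(a_k−2ΛF/m)/(2Λ²/m)}`** for `|G| ≤ M·1{a_k ≤ |ℓ_k| ∀k}` (`abs_gexp_le_shell`).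
* §2 (the located data): `prec blk Δ X s` is positive definite and inherits `Δ ≥ m` for every `s ∈ [0,1]^I` (`prec_posDef_of_mem_cube`,
  `dotProduct_prec_mulVec_ge_of_mem_cube` — p. 305 *"To preserve positivity and boundedness properties of the inverse covariance"*), so for
  linear slot fields `Φ_b` with the frame letter of `BIJ88GaussMultiShell307`: **`|⟨G⟩_{s,X}| ≤ M · Π_{b∈B′} 2e^{−a_b(a_b−2ΛF/m)/(2Λ²/m)}`
  whenever `|G(ω)| ≤ M·1{a_b ≤ |Φ_b(ext ω)| ∀ b ∈ B′}`** (`abs_gexp_prec_le_shell`) — ONE GAUSSIAN SHELL FACTOR PER HIT χ-SLOT, uniformly in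
  the interpolation parameter, the form in which the located (5.14.4) (row C2.Eq5.14.3-5.14.4, §f estimate E4) integrates the terms of
  `BIJ88TrainsDsetExpansion306` / `BIJ88CubeProductDset306` / `BIJ88ChiMixedDerivN309`.

statement-level skeleton of published theorems with citation tags; proofs where landed; nothing here is a claim about the Yang–Mills mass gap

PDF held: `paper:balaban1988-cmp114-bij-abelian-higgs-effective-action` (journal page = PDF page + 256); pages re-read this session as text:
PDF 49 (p. 305), PDF 51 (p. 307) L4–12, PDF 53 (p. 309).

CITATION HEADER (lean-in-tree rule).  Part of the lit-balaban TYPED SKELETON (HOME `run/shared/lean/pub/lit-balaban/`), Phase 2, seat p36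
(gen 21, unit `lit-balaban-p36`); rows **C2.Eq5.14.3-5.14.4** (member: §f estimate E4a — the Gaussian integration of the shell indicators at
interpolated `s`) and C2.Eq5.13.3-5.13.4 (member: `⟨·⟩_s` as a translated Gaussian probability) of `HOME/lit-balaban-r16/ROWS-C2-part2.md`
(owner r16, referee ref-5).  Theorem-only; no definitions, no `Prop` facts; axioms standard.
HONEST SCOPE.  The Chebyshev/Chernoff route of `BIJ88GaussMultiShell307` (not [3] § 14, which is not held); real scalar fields on finite carriers;
the frame letter `Λ`, the coercivity `m` and the source bound `F` are inputs.
-/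

namespace Literature.MathematicalPhysics.QuantumFieldTheory.BalabanImbrieJaffe1984to88.BIJ88GaussShellInterpolated309

open MeasureTheory ProbabilityTheory Finset Matrix
open scoped BigOperators
open Literature.MathematicalPhysics.QuantumFieldTheory.Balaban1983to89
open B13GaugeDevices (gaussNorm gaussInt)
open B2Eq228Conditioning (weight source gaussProb isProbabilityMeasure_gaussProb gaussNorm_pos integral_tilt integral_gaussProb_eq)
open BIJ88TruncationConnected306 (gexp)
open BIJ88PolymerRep5134Gauss (ext prec src)
open BIJ88DirichletForms305 (interpForm interpForm_posDef quadForm_interpForm_ge)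
open BIJ88SlotFieldGaussBounds (sum_eq_sum_site ext_dotProduct_ext dotProduct_inv_mulVec_le abs_dotProduct_inv_mulVec_le
  abs_dotProduct_le_sqrt_mul_sqrt)
open BIJ88GaussMultiShell307 (measureReal_forall_abs_ge_le_of_hasGaussianLaw)

/-! ## §1  `⟨·⟩` with precision `A` and source `f` is the Gaussian `dμ_{A⁻¹}` translated by `A⁻¹f` -/

section Generic

variable {n : Type} [Fintype n] [DecidableEq n] {A : Matrix n n ℝ}

/-- **completing the square in the numerator**: `∫ G e^{−½⟨φ,Aφ⟩}e^{⟨f,φ⟩} dφ = e^{½⟨f,A⁻¹f⟩}·gaussNorm(A)·∫ G(z + A⁻¹f) dμ_{A⁻¹}(z)`.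
[cite: BalabanImbrieJaffe1988, §5.13 p.305] -/
theorem integral_mul_weight_mul_source_eq (hA : A.PosDef) (f : n → ℝ) (G : (n → ℝ) → ℝ) :
    ∫ φ, G φ * (weight A φ * source f φ)
      = Real.exp (1 / 2 * (f ⬝ᵥ (A⁻¹ *ᵥ f))) * gaussNorm A * ∫ z, G (z + A⁻¹ *ᵥ f) ∂(gaussProb A) := by
  have hAs : A.IsSymm := by
    have h := hA.isHermitian.eq
    rwa [conjTranspose_eq_transpose_of_trivial] at h
  have hdet : IsUnit A.det := isUnit_iff_ne_zero.2 hA.det_pos.ne'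
  have h1 : ∫ φ, G φ * (weight A φ * source f φ) = ∫ φ, Real.exp (-((-f) ⬝ᵥ φ) - 1 / 2 * (φ ⬝ᵥ (A *ᵥ φ))) * G φ := by
    refine integral_congr_ae (Filter.Eventually.of_forall fun φ => ?_)
    show G φ * (weight A φ * source f φ) = _
    rw [BIJ88ExpectTilt305.weight_mul_source_eq_tilt, mul_comm]
  rw [h1, integral_tilt A hAs hdet (-f) G, integral_gaussProb_eq]
  have hn : (-f) ⬝ᵥ (A⁻¹ *ᵥ (-f)) = f ⬝ᵥ (A⁻¹ *ᵥ f) := by rw [mulVec_neg, neg_dotProduct, dotProduct_neg, neg_neg]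
  have hm : ∀ z : n → ℝ, z - A⁻¹ *ᵥ (-f) = z + A⁻¹ *ᵥ f := fun z => by rw [mulVec_neg, sub_neg_eq_add]
  simp only [hn, hm, gaussInt, smul_eq_mul]
  rw [mul_assoc, ← mul_assoc (gaussNorm A), mul_inv_cancel₀ (gaussNorm_pos hA).ne', one_mul]

/-- **`⟨G⟩ = ∫ G(z + A⁻¹f) dμ_{A⁻¹}(z)`**: the normalized expectation with precision `A ≻ 0` and source `f` is the mean of `G` over the centred
probability Gaussian of covariance `A⁻¹` translated by the mean field `A⁻¹f`. [cite: BalabanImbrieJaffe1988, §5.13 p.305] -/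
theorem gexp_eq_integral_shift (hA : A.PosDef) (f : n → ℝ) (G : (n → ℝ) → ℝ) :
    gexp A f G = ∫ z, G (z + A⁻¹ *ᵥ f) ∂(gaussProb A) := by
  haveI := isProbabilityMeasure_gaussProb hA
  have hE : Real.exp (1 / 2 * (f ⬝ᵥ (A⁻¹ *ᵥ f))) * gaussNorm A ≠ 0 := mul_ne_zero (Real.exp_pos _).ne' (gaussNorm_pos hA).ne'
  have h1 : ∫ φ, weight A φ * source f φ = Real.exp (1 / 2 * (f ⬝ᵥ (A⁻¹ *ᵥ f))) * gaussNorm A := by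
    have h := integral_mul_weight_mul_source_eq hA f (fun _ => 1)
    simp only [one_mul] at h
    rw [h, integral_const, smul_eq_mul, mul_one, probReal_univ, mul_one]
  simp only [gexp]
  rw [integral_mul_weight_mul_source_eq hA f G, h1, mul_div_cancel_left₀ _ hE]

/-- … as an integral against the translated law `dμ_{A⁻¹} ∘ (· + A⁻¹f)⁻¹`. [cite: BalabanImbrieJaffe1988, §5.13 p.305] -/
theorem gexp_eq_integral_map (hA : A.PosDef) (f : n → ℝ) (G : (n → ℝ) → ℝ) :
    gexp A f G = ∫ ω, G ω ∂((gaussProb A).map fun z => z + A⁻¹ *ᵥ f) := by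
  rw [gexp_eq_integral_shift hA f G, show (fun z : n → ℝ => z + A⁻¹ *ᵥ f) = ⇑(MeasurableEquiv.addRight (A⁻¹ *ᵥ f)) from rfl,
    integral_map_equiv]
  rfl

omit [Fintype n] [DecidableEq n] in
/-- the translated law is a probability measure. [cite: BalabanImbrieJaffe1988, §5.13 p.305] -/
theorem isProbabilityMeasure_shift {μ : Measure (n → ℝ)} [IsProbabilityMeasure μ] (v : n → ℝ) :
    IsProbabilityMeasure (μ.map fun z => z + v) :=
  Measure.isProbabilityMeasure_map (measurable_add_const v).aemeasurable

/-- **`|⟨G⟩| ≤ M · Law(S)` when `|G| ≤ M·1_S`** (`S` measurable): the only way the Gaussian integral sees a factor supported in a shell.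
[cite: BalabanImbrieJaffe1988, §5.13 p.307] -/
theorem abs_gexp_le_of_indicator (hA : A.PosDef) (f : n → ℝ) {G : (n → ℝ) → ℝ} {S : Set (n → ℝ)} (hS : MeasurableSet S) {M : ℝ}
    (hG : ∀ ω, |G ω| ≤ M * S.indicator 1 ω) :
    |gexp A f G| ≤ M * ((gaussProb A).map fun z => z + A⁻¹ *ᵥ f).real S := by
  haveI := isProbabilityMeasure_gaussProb hA
  haveI := isProbabilityMeasure_shift (μ := gaussProb A) (A⁻¹ *ᵥ f)
  rw [gexp_eq_integral_map hA f G]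
  refine abs_integral_le_integral_abs.trans ?_
  calc ∫ ω, |G ω| ∂((gaussProb A).map fun z => z + A⁻¹ *ᵥ f)
      ≤ ∫ ω, M * S.indicator 1 ω ∂((gaussProb A).map fun z => z + A⁻¹ *ᵥ f) :=
        integral_mono_of_nonneg (Filter.Eventually.of_forall fun ω => abs_nonneg _)
          (((integrable_const (1 : ℝ)).indicator hS).const_mul M) (Filter.Eventually.of_forall hG)
    _ = M * ((gaussProb A).map fun z => z + A⁻¹ *ᵥ f).real S := by
        rw [integral_const_mul, integral_indicator_one hS]

/-- **linear functionals are jointly Gaussian under the translated law** (p. 308: *"a purely Gaussian expectation"*).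
[cite: BalabanImbrieJaffe1988, §5.13 p.305, (5.14.2) p.308] -/
theorem hasGaussianLaw_linear_shift (hA : A.PosDef) (v : n → ℝ) {κ : Type*} [Fintype κ] {ℓ : κ → (n → ℝ) → ℝ}
    (hℓ : ∀ k, IsLinearMap ℝ (ℓ k)) : HasGaussianLaw (fun ω k => ℓ k ω) ((gaussProb A).map fun z => z + v) := by
  haveI := BIJ88EffectiveActionGauss308.isGaussian_gaussProb hA
  let T : (n → ℝ) →ₗ[ℝ] (κ → ℝ) := LinearMap.pi fun k => (hℓ k).mk' (ℓ k)
  have hT : (fun (ω : n → ℝ) k => ℓ k ω) = ⇑(LinearMap.toContinuousLinearMap T) ∘ id := by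
    funext ω k
    simp [T]
  rw [hT]
  exact IsGaussian.hasGaussianLaw_id.map _

omit [DecidableEq n] in
/-- a linear functional on `n → ℝ` is `ω ↦ a·ω` with `a_i = ℓ(δ_i)`. [cite: BalabanImbrieJaffe1988, (5.14.2) p.308] -/
theorem linear_eq_dotProduct [DecidableEq n] {ℓ : (n → ℝ) → ℝ} (hℓ : IsLinearMap ℝ ℓ) (ω : n → ℝ) :
    ℓ ω = (fun i => ℓ (Pi.single i 1)) ⬝ᵥ ω := by
  have h := LinearMap.pi_apply_eq_sum_univ (hℓ.mk' ℓ) ω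
  rw [IsLinearMap.mk'_apply] at h
  rw [h, dotProduct_comm]
  refine Finset.sum_congr rfl fun i _ => ?_
  have hfun : (Pi.single i (1 : ℝ) : n → ℝ) = fun j => if i = j then 1 else 0 := by
    funext j
    simp [Pi.single_apply, eq_comm]
  rw [smul_eq_mul, IsLinearMap.mk'_apply]
  show _ = ω i * ℓ (Pi.single i 1)
  rw [hfun]

omit [DecidableEq n] in
/-- `ω ↦ a·ω` is measurable. [folklore] [cite: BalabanImbrieJaffe1988, (5.14.2) p.308] -/
theorem measurable_dotProduct (a : n → ℝ) : Measurable fun ω : n → ℝ => a ⬝ᵥ ω :=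
  Finset.measurable_sum _ fun i _ => measurable_const.mul (measurable_pi_apply i)

/-- **`Var[a·ω] = a·A⁻¹a` under the translated law** (a translation does not change the variance).
[cite: BalabanImbrieJaffe1988, p.304 (Sect. 5.13), §5.13 p.305] -/
theorem variance_dotProduct_shift (hA : A.PosDef) (v a : n → ℝ) :
    Var[fun ω => a ⬝ᵥ ω; (gaussProb A).map fun z => z + v] = a ⬝ᵥ (A⁻¹ *ᵥ a) := by
  haveI := isProbabilityMeasure_gaussProb hA
  rw [variance_map (measurable_dotProduct a).aemeasurable (measurable_add_const v).aemeasurable]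
  have hcomp : ((fun ω : n → ℝ => a ⬝ᵥ ω) ∘ fun z => z + v) = fun z => a ⬝ᵥ z + a ⬝ᵥ v := by
    funext z
    simp only [Function.comp_apply, dotProduct_add]
  rw [hcomp, variance_add_const (measurable_dotProduct a).aestronglyMeasurable,
    BIJ88SlotFieldGaussBounds.variance_dotProduct_gaussProb hA]

/-- **`E[a·ω] = a·v` under the law translated by `v`** (the centred Gaussian has mean zero).
[cite: BalabanImbrieJaffe1988, §5.13 p.305] -/
theorem integral_dotProduct_shift (hA : A.PosDef) (v a : n → ℝ) :
    ∫ ω, a ⬝ᵥ ω ∂((gaussProb A).map fun z => z + v) = a ⬝ᵥ v := by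
  haveI := isProbabilityMeasure_gaussProb hA
  rw [show (fun z : n → ℝ => z + v) = ⇑(MeasurableEquiv.addRight v) from rfl, integral_map_equiv]
  simp only [MeasurableEquiv.coe_addRight, dotProduct]
  have hint : ∀ i ∈ (Finset.univ : Finset n), Integrable (fun x : n → ℝ => a i * (x + v) i) (gaussProb A) := fun i _ => by
    have h := ((BIJ88CondMoments305.integrable_apply_gaussProb hA i).add (integrable_const (v i))).const_mul (a i)
    exact h.congr (Filter.Eventually.of_forall fun x => rfl)
  rw [integral_finsetSum _ hint]
  exact Finset.sum_congr rfl fun i _ => by rw [integral_const_mul, BIJ88CondMoments305.integral_add_apply_gaussProb hA v i]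

omit [Fintype n] [DecidableEq n] in
/-- **the coefficient vector of a `Λ`-bounded functional has norm `≤ Λ`**: `a·a ≤ Λ²` if `|ℓ ω| ≤ Λ‖ω‖₂` (`a·a = ℓ(a) ≤ Λ‖a‖₂`).
[cite: BalabanImbrieJaffe1988, (5.14.2) p.308] -/
theorem dotProduct_coef_self_le [Fintype n] [DecidableEq n] {ℓ : (n → ℝ) → ℝ} (hℓ : IsLinearMap ℝ ℓ) {Λ : ℝ} (hΛ0 : 0 ≤ Λ)
    (hΛ : ∀ ω : n → ℝ, |ℓ ω| ≤ Λ * Real.sqrt (ω ⬝ᵥ ω)) :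
    (fun i => ℓ (Pi.single i 1)) ⬝ᵥ (fun i => ℓ (Pi.single i 1)) ≤ Λ ^ 2 := by
  set a : n → ℝ := fun i => ℓ (Pi.single i 1) with ha
  have h0 : 0 ≤ a ⬝ᵥ a := Finset.sum_nonneg fun i _ => mul_self_nonneg (a i)
  have h2 : a ⬝ᵥ a ≤ Λ * Real.sqrt (a ⬝ᵥ a) := by
    calc a ⬝ᵥ a = ℓ a := by rw [linear_eq_dotProduct hℓ a, ← ha]
      _ ≤ |ℓ a| := le_abs_self _
      _ ≤ Λ * Real.sqrt (a ⬝ᵥ a) := hΛ a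
  have h3 : Real.sqrt (a ⬝ᵥ a) ≤ Λ := by
    rcases (Real.sqrt_nonneg (a ⬝ᵥ a)).eq_or_lt with hz | hpos
    · rw [← hz]; exact hΛ0
    · have : Real.sqrt (a ⬝ᵥ a) * Real.sqrt (a ⬝ᵥ a) ≤ Λ * Real.sqrt (a ⬝ᵥ a) := by rwa [Real.mul_self_sqrt h0]
      exact le_of_mul_le_mul_right this hpos
  calc a ⬝ᵥ a = Real.sqrt (a ⬝ᵥ a) ^ 2 := (Real.sq_sqrt h0).symm
    _ ≤ Λ ^ 2 := pow_le_pow_left₀ (Real.sqrt_nonneg _) h3 2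

/-- **STRUCTURAL VARIANCE BOUND under the translated law**: `A ≥ m` (`m > 0`), `ℓ` linear with `|ℓ ω| ≤ Λ‖ω‖₂` ⇒ `Var[ℓ] ≤ Λ²/m`.
[cite: BalabanImbrieJaffe1988, p.304 (Sect. 5.13), §5.13 p.305] -/
theorem variance_linear_shift_le (hA : A.PosDef) {m : ℝ} (hm : 0 < m) (hAm : ∀ w : n → ℝ, m * (w ⬝ᵥ w) ≤ w ⬝ᵥ (A *ᵥ w)) (v : n → ℝ)
    {ℓ : (n → ℝ) → ℝ} (hℓ : IsLinearMap ℝ ℓ) {Λ : ℝ} (hΛ0 : 0 ≤ Λ) (hΛ : ∀ ω : n → ℝ, |ℓ ω| ≤ Λ * Real.sqrt (ω ⬝ᵥ ω)) :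
    Var[ℓ; (gaussProb A).map fun z => z + v] ≤ Λ ^ 2 / m := by
  have h1 : ℓ = fun ω => (fun i => ℓ (Pi.single i 1)) ⬝ᵥ ω := funext fun ω => linear_eq_dotProduct hℓ ω
  rw [h1, variance_dotProduct_shift hA]
  refine (dotProduct_inv_mulVec_le hA hm hAm _).trans ?_
  gcongr
  exact dotProduct_coef_self_le hℓ hΛ0 hΛ

/-- **STRUCTURAL MEAN BOUND under the translated law**: `A ≥ m`, `|ℓ ω| ≤ Λ‖ω‖₂`, `‖f‖₂ ≤ F` ⇒ `|E ℓ| ≤ ΛF/m` (translation by `A⁻¹f`; the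
mean vanishes where *"the translation vanishes"*, `f = 0`). [cite: BalabanImbrieJaffe1988, §5.13 p.307] -/
theorem abs_integral_linear_shift_le (hA : A.PosDef) {m : ℝ} (hm : 0 < m) (hAm : ∀ w : n → ℝ, m * (w ⬝ᵥ w) ≤ w ⬝ᵥ (A *ᵥ w))
    (f : n → ℝ) {ℓ : (n → ℝ) → ℝ} (hℓ : IsLinearMap ℝ ℓ) {Λ : ℝ} (hΛ0 : 0 ≤ Λ) (hΛ : ∀ ω : n → ℝ, |ℓ ω| ≤ Λ * Real.sqrt (ω ⬝ᵥ ω))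
    {F : ℝ} (hF0 : 0 ≤ F) (hF : f ⬝ᵥ f ≤ F ^ 2) :
    |∫ ω, ℓ ω ∂((gaussProb A).map fun z => z + A⁻¹ *ᵥ f)| ≤ Λ * F / m := by
  have h1 : ℓ = fun ω => (fun i => ℓ (Pi.single i 1)) ⬝ᵥ ω := funext fun ω => linear_eq_dotProduct hℓ ω
  rw [h1, integral_dotProduct_shift hA]
  refine (abs_dotProduct_inv_mulVec_le hA hm hAm _ _).trans ?_
  have ha : Real.sqrt ((fun i => ℓ (Pi.single i 1)) ⬝ᵥ fun i => ℓ (Pi.single i 1)) ≤ Λ := by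
    rw [← Real.sqrt_sq hΛ0]
    exact Real.sqrt_le_sqrt (dotProduct_coef_self_le hℓ hΛ0 hΛ)
  have hf : Real.sqrt (f ⬝ᵥ f) ≤ F := by
    rw [← Real.sqrt_sq hF0]
    exact Real.sqrt_le_sqrt hF
  gcongr

omit [DecidableEq n] in
/-- the frame letter at a single functional: `|ℓ_k ω| ≤ Λ‖ω‖₂` (take `θ = δ_k`). [cite: BalabanImbrieJaffe1988, (5.14.2) p.308] -/
theorem abs_le_of_frame {κ : Type*} [Fintype κ] [DecidableEq κ] {ℓ : κ → (n → ℝ) → ℝ} {Λ : ℝ}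
    (hframe : ∀ (θ : κ → ℝ) (ω : n → ℝ), |∑ k, θ k * ℓ k ω| ≤ Λ * Real.sqrt (∑ k, θ k ^ 2) * Real.sqrt (ω ⬝ᵥ ω)) (k : κ) (ω : n → ℝ) :
    |ℓ k ω| ≤ Λ * Real.sqrt (ω ⬝ᵥ ω) := by
  have h := hframe (Pi.single k 1) ω
  have h1 : ∑ k', (Pi.single k (1 : ℝ) : κ → ℝ) k' * ℓ k' ω = ℓ k ω := by
    rw [Finset.sum_eq_single k (fun k' _ hk' => by rw [Pi.single_eq_of_ne hk', zero_mul]) (fun hk => absurd (Finset.mem_univ k) hk),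
      Pi.single_eq_same, one_mul]
  have h2 : ∑ k', (Pi.single k (1 : ℝ) : κ → ℝ) k' ^ 2 = 1 := by
    rw [Finset.sum_eq_single k (fun k' _ hk' => by rw [Pi.single_eq_of_ne hk']; ring) (fun hk => absurd (Finset.mem_univ k) hk),
      Pi.single_eq_same, one_pow]
  rw [h1, h2, Real.sqrt_one, mul_one] at h
  exact h

omit [Fintype n] [DecidableEq n] in
/-- a finite linear combination of linear functionals is linear. [cite: BalabanImbrieJaffe1988, (5.14.2) p.308] -/
theorem isLinearMap_sum {κ : Type*} [Fintype κ] {ℓ : κ → (n → ℝ) → ℝ} (hℓ : ∀ k, IsLinearMap ℝ (ℓ k)) (θ : κ → ℝ) :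
    IsLinearMap ℝ fun ω : n → ℝ => ∑ k, θ k * ℓ k ω := by
  refine ⟨fun φ ψ => ?_, fun r φ => ?_⟩
  · rw [← Finset.sum_add_distrib]
    exact Finset.sum_congr rfl fun k _ => by rw [(hℓ k).map_add]; ring
  · rw [Finset.smul_sum]
    exact Finset.sum_congr rfl fun k _ => by rw [(hℓ k).map_smul]; simp only [smul_eq_mul]; ring

/-- **THE MULTI-SHELL BOUND UNDER THE TRANSLATED LAW**: `A ≥ m` (`m > 0`), linear `ℓ_k` with the frame letter
`|Σ_kθ_kℓ_k(ω)| ≤ Λ‖θ‖₂‖ω‖₂` (`Λ > 0`), `‖f‖₂ ≤ F`, thresholds `a_k ≥ 0`: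
`Law{a_k ≤ |ℓ_k| for all k} ≤ Π_k 2e^{−a_k(a_k − 2ΛF/m)/(2Λ²/m)}` (`BIJ88GaussMultiShell307` §1 fed with §1 here).
[cite: BalabanImbrieJaffe1988, §5.13 p.307] -/
theorem shift_real_forall_abs_ge_le {κ : Type*} [Fintype κ] [DecidableEq κ] (hA : A.PosDef) {m : ℝ} (hm : 0 < m)
    (hAm : ∀ w : n → ℝ, m * (w ⬝ᵥ w) ≤ w ⬝ᵥ (A *ᵥ w)) (f : n → ℝ) {ℓ : κ → (n → ℝ) → ℝ} (hℓ : ∀ k, IsLinearMap ℝ (ℓ k)) {Λ : ℝ}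
    (hΛ : 0 < Λ) (hframe : ∀ (θ : κ → ℝ) (ω : n → ℝ), |∑ k, θ k * ℓ k ω| ≤ Λ * Real.sqrt (∑ k, θ k ^ 2) * Real.sqrt (ω ⬝ᵥ ω))
    {F : ℝ} (hF0 : 0 ≤ F) (hF : f ⬝ᵥ f ≤ F ^ 2) {a : κ → ℝ} (ha : ∀ k, 0 ≤ a k) :
    ((gaussProb A).map fun z => z + A⁻¹ *ᵥ f).real {ω | ∀ k, a k ≤ |ℓ k ω|} ≤
      ∏ k, 2 * Real.exp (-(a k * (a k - 2 * (Λ * F / m)) / (2 * (Λ ^ 2 / m)))) := by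
  have hJ := hasGaussianLaw_linear_shift hA (A⁻¹ *ᵥ f) hℓ
  haveI := hJ.isProbabilityMeasure
  refine measureReal_forall_abs_ge_le_of_hasGaussianLaw (X := fun k ω => ℓ k ω) hJ (by positivity) (fun θ => ?_) (fun k => ?_) ha
  · have hθ : 0 ≤ ∑ k, θ k ^ 2 := Finset.sum_nonneg fun k _ => sq_nonneg _
    have h := variance_linear_shift_le hA hm hAm (A⁻¹ *ᵥ f) (isLinearMap_sum hℓ θ) (Λ := Λ * Real.sqrt (∑ k, θ k ^ 2))
      (by positivity) (fun ω => hframe θ ω)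
    refine h.trans (le_of_eq ?_)
    rw [mul_pow, Real.sq_sqrt hθ]; ring
  · exact abs_integral_linear_shift_le hA hm hAm f (hℓ k) hΛ.le (abs_le_of_frame hframe k) hF0 hF

/-- **`|⟨G⟩| ≤ M · Π_k 2e^{−a_k(a_k−2ΛF/m)/(2Λ²/m)}` for a factor supported in the shells, `|G| ≤ M·1{a_k ≤ |ℓ_k| ∀k}`** — the Gaussian
integration step of print's estimate, for ANY precision `A ≥ m` and source `‖f‖₂ ≤ F`. [cite: BalabanImbrieJaffe1988, §5.13 p.307, (5.14.4) p.309] -/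
theorem abs_gexp_le_shell {κ : Type*} [Fintype κ] [DecidableEq κ] (hA : A.PosDef) {m : ℝ} (hm : 0 < m)
    (hAm : ∀ w : n → ℝ, m * (w ⬝ᵥ w) ≤ w ⬝ᵥ (A *ᵥ w)) (f : n → ℝ) {ℓ : κ → (n → ℝ) → ℝ} (hℓ : ∀ k, IsLinearMap ℝ (ℓ k)) {Λ : ℝ}
    (hΛ : 0 < Λ) (hframe : ∀ (θ : κ → ℝ) (ω : n → ℝ), |∑ k, θ k * ℓ k ω| ≤ Λ * Real.sqrt (∑ k, θ k ^ 2) * Real.sqrt (ω ⬝ᵥ ω))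
    {F : ℝ} (hF0 : 0 ≤ F) (hF : f ⬝ᵥ f ≤ F ^ 2) {a : κ → ℝ} (ha : ∀ k, 0 ≤ a k) {G : (n → ℝ) → ℝ} {M : ℝ} (hM : 0 ≤ M)
    (hG : ∀ ω, |G ω| ≤ M * {ω : n → ℝ | ∀ k, a k ≤ |ℓ k ω|}.indicator 1 ω) :
    |gexp A f G| ≤ M * ∏ k, 2 * Real.exp (-(a k * (a k - 2 * (Λ * F / m)) / (2 * (Λ ^ 2 / m)))) := by
  have hcont : ∀ k, Continuous (ℓ k) := fun k => ((hℓ k).mk' (ℓ k)).continuous_of_finiteDimensional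
  have hS : MeasurableSet {ω : n → ℝ | ∀ k, a k ≤ |ℓ k ω|} := by
    have h1 : {ω : n → ℝ | ∀ k, a k ≤ |ℓ k ω|} = ⋂ k, {ω | a k ≤ |ℓ k ω|} := by
      ext ω
      simp
    rw [h1]
    exact MeasurableSet.iInter fun k => measurableSet_le measurable_const (continuous_abs.measurable.comp (hcont k).measurable)
  exact (abs_gexp_le_of_indicator hA f hS hG).trans
    (mul_le_mul_of_nonneg_left (shift_real_forall_abs_ge_le hA hm hAm f hℓ hΛ hframe hF0 hF ha) hM)

end Generic

/-! ## §2  The located data: `⟨·⟩_{s,X}` with precision `prec blk Δ X s`, `s ∈ [0,1]^I` -/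

section Located

variable {α I : Type} [Fintype α] [DecidableEq α] [Fintype I] [DecidableEq I] (blk : α → I) (Δ : Matrix α α ℝ) (ℱ : α → ℝ)

/-- **positivity is preserved** (p. 305): `prec blk Δ X s = (Δ_s)|_X` is positive definite for `s ∈ [0,1]^I` — a principal block of the
positive definite `Δ_s` (`BIJ88DirichletForms305.interpForm_posDef`). [cite: BalabanImbrieJaffe1988, §5.13 p.305] -/
theorem prec_posDef_of_mem_cube (hΔ : Δ.PosDef) {s : I → ℝ} (hs : ∀ i, 0 ≤ s i ∧ s i ≤ 1) (X : Finset I) :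
    (prec blk Δ X s).PosDef :=
  (interpForm_posDef blk hΔ hs).submatrix Subtype.val_injective

/-- the form `Δ_s` on extended fields is the block `(Δ_s)|_X` on the fields of `X`. [cite: BalabanImbrieJaffe1988, §5.13 p.305] -/
theorem ext_dotProduct_interpForm_mulVec_ext (s : I → ℝ) (X : Finset I) (v : {x : α // blk x ∈ X} → ℝ) :
    ext blk X v ⬝ᵥ (interpForm blk Δ s *ᵥ ext blk X v) = v ⬝ᵥ (prec blk Δ X s *ᵥ v) := by
  unfold dotProduct
  rw [sum_eq_sum_site blk X (g := fun x => ext blk X v x * (interpForm blk Δ s *ᵥ ext blk X v) x)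
    (fun x hx => by simp [BIJ88PolymerRep5134Gauss.ext, hx])]
  refine Finset.sum_congr rfl fun x _ => ?_
  have hx : ext blk X v x.1 = v x := by simp [BIJ88PolymerRep5134Gauss.ext, x.2]
  rw [hx]
  congr 1
  simp only [mulVec, dotProduct]
  rw [sum_eq_sum_site blk X (g := fun y => interpForm blk Δ s x.1 y * ext blk X v y)
    (fun y hy => by simp [BIJ88PolymerRep5134Gauss.ext, hy])]
  refine Finset.sum_congr rfl fun y _ => ?_
  simp [BIJ88PolymerRep5134Gauss.prec, BIJ88PolymerRep5134Gauss.ext, y.2]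

/-- **boundedness below is preserved**: `Δ ≥ m ⇒ (Δ_s)|_X ≥ m` for every `s ∈ [0,1]^I` (`BIJ88DirichletForms305.quadForm_interpForm_ge`).
[cite: BalabanImbrieJaffe1988, §5.13 p.305] -/
theorem dotProduct_prec_mulVec_ge_of_mem_cube {m : ℝ} (hΔm : ∀ φ : α → ℝ, m * (φ ⬝ᵥ φ) ≤ φ ⬝ᵥ (Δ *ᵥ φ)) {s : I → ℝ}
    (hs : ∀ i, 0 ≤ s i ∧ s i ≤ 1) (X : Finset I) (v : {x : α // blk x ∈ X} → ℝ) : m * (v ⬝ᵥ v) ≤ v ⬝ᵥ (prec blk Δ X s *ᵥ v) := by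
  rw [← ext_dotProduct_ext blk X v v, ← ext_dotProduct_interpForm_mulVec_ext blk Δ s X v]
  exact quadForm_interpForm_ge blk hΔm hs _

variable {ι : Type*} (B' : Finset ι) {Φ : ι → (α → ℝ) → ℝ}

/-- **ONE GAUSSIAN SHELL FACTOR PER HIT χ-SLOT UNDER `⟨·⟩_{s,X}`, UNIFORMLY IN `s`**: `Δ` positive definite with `Δ ≥ m` (`m > 0`),
`s ∈ [0,1]^I`, linear slot fields `Φ_b` (`b ∈ B′`) with the frame letter `|Σ_bθ_bΦ_b(φ)| ≤ Λ‖θ‖₂‖φ‖₂` (`Λ > 0`), source `‖ℱ|_X‖₂ ≤ F`, thresholds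
`a_b ≥ 0`; if `|G(ω)| ≤ M · 1{a_b ≤ |Φ_b(ext ω)| for all b ∈ B′}` then
`|gexp (prec blk Δ X s) (src blk ℱ X) G| ≤ M · Π_{b∈B′} 2e^{−a_b(a_b − 2ΛF/m)/(2Λ²/m)}`.
[cite: BalabanImbrieJaffe1988, §5.13 p.307, (5.14.3)–(5.14.4) p.309] -/
theorem abs_gexp_prec_le_shell [DecidableEq ι] (hΔ : Δ.PosDef) {m : ℝ} (hm : 0 < m) (hΔm : ∀ φ : α → ℝ, m * (φ ⬝ᵥ φ) ≤ φ ⬝ᵥ (Δ *ᵥ φ))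
    {s : I → ℝ} (hs : ∀ i, 0 ≤ s i ∧ s i ≤ 1) (X : Finset I) (hlin : ∀ b ∈ B', IsLinearMap ℝ (Φ b)) {Λ : ℝ} (hΛ : 0 < Λ)
    (hframe : ∀ (θ : ↥B' → ℝ) (φ : α → ℝ), |∑ b : ↥B', θ b * Φ b φ| ≤ Λ * Real.sqrt (∑ b : ↥B', θ b ^ 2) * Real.sqrt (φ ⬝ᵥ φ))
    {F : ℝ} (hF0 : 0 ≤ F) (hF : src blk ℱ X ⬝ᵥ src blk ℱ X ≤ F ^ 2) {a : ↥B' → ℝ} (ha : ∀ b, 0 ≤ a b)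
    {G : ({x : α // blk x ∈ X} → ℝ) → ℝ} {M : ℝ} (hM : 0 ≤ M)
    (hG : ∀ ω, |G ω| ≤ M * {ω : {x : α // blk x ∈ X} → ℝ | ∀ b : ↥B', a b ≤ |Φ b (ext blk X ω)|}.indicator 1 ω) :
    |gexp (prec blk Δ X s) (src blk ℱ X) G| ≤ M * ∏ b : ↥B', 2 * Real.exp (-(a b * (a b - 2 * (Λ * F / m)) / (2 * (Λ ^ 2 / m)))) := by
  have hℓ : ∀ b : ↥B', IsLinearMap ℝ fun ω : {x : α // blk x ∈ X} → ℝ => Φ b (ext blk X ω) := fun b =>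
    ⟨fun ω ω' => by rw [(BIJ88EffectiveActionGauss308.isLinearMap_ext blk X).map_add, (hlin b b.2).map_add],
      fun r ω => by rw [(BIJ88EffectiveActionGauss308.isLinearMap_ext blk X).map_smul, (hlin b b.2).map_smul]⟩
  have hframe' : ∀ (θ : ↥B' → ℝ) (ω : {x : α // blk x ∈ X} → ℝ),
      |∑ b : ↥B', θ b * Φ b (ext blk X ω)| ≤ Λ * Real.sqrt (∑ b : ↥B', θ b ^ 2) * Real.sqrt (ω ⬝ᵥ ω) := fun θ ω => by
    rw [← ext_dotProduct_ext blk X ω ω]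
    exact hframe θ (ext blk X ω)
  exact abs_gexp_le_shell (prec_posDef_of_mem_cube blk Δ hΔ hs X) hm (dotProduct_prec_mulVec_ge_of_mem_cube blk Δ hΔm hs X)
    (src blk ℱ X) hℓ hΛ hframe' hF0 hF ha hM hG

end Located

end Literature.MathematicalPhysics.QuantumFieldTheory.BalabanImbrieJaffe1984to88.BIJ88GaussShellInterpolated309
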